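import Mathlib
import Summits.NavierStokesRegularity.NavierStokesRegularity.Theorems.LerayQuarterDissipationFiniteDissipationLiouvilleSmallDissipationGapSharper
import Summits.NavierStokesRegularity.NavierStokesRegularity.Theorems.LerayQuarterDissipationFiniteDissipationLiouvilleVorticityAmplitudeTools
import HarnessLib

/-!
# Crux `FiniteDissipationLiouville` (stmt-NavierStokesRegularity-22144): FORWARD TRAPPING of the
# similarity enstrophy below the explicit dissipation threshold (file 1/2: tools — window
# comparison, `R → ∞`, the SLICE-WISE budget, the weights)

Theorems file of route `LerayQuarterDissipation` (lead prover g17; `--supports` the crux; portrait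
fact for the registered stub `stub_envelopeCriticalLiouville` of skeleton `Lines/birth.lean`).
Navier–Stokes regularity is NOT proved by anything here; no summit is.

`𝒟_{C,K}`: Type-I ancient mild fields `V` in the KNSS gauge (`IsTypeIAncientMild C V`) with Leray's
quarter-rate law `∫‖DV(t)‖² ≤ K/√(−t)`; similarity variables `U(s) = lerayOrbit V s`,
`Ω(s) = curl U(s) = lerayVorticity V s`, `t = −e^{−s}`; the global similarity enstrophy
`Z(s) = ∫‖Ω(s)‖² = √(−t)∫‖curl V(t)‖²dx` is finite on the stratum and dominates the law's
quantity, `∫‖DU(s)‖² ≤ Z(s)` (`…VorticityAmplitude.integral_sq_norm_fderiv_lerayOrbit_le`).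
`K_S` = Mathlib's Gagliardo–Nirenberg–Sobolev constant `SNormLESNormFDerivOfEqConst ℝ³ volume 2`.

A NEW MECHANISM for the line — FORWARD INVARIANCE instead of backward (ancient) rigidity. The
localised similarity-enstrophy budget with the Ladyzhenskaya pricing of the stretching term
(`…SmallDissipationGap.two_mul_integral_sqCutoff_stretching_le_weighted`, lead g14) is
SELF-IMPROVING: pricing the slice `s` by its own dissipation `∫‖DU(s)‖² ≤ Z(s)` gives, formally,
`Z' ≤ −½Z + (27/128)K_S⁶ Z³`, so the sub-threshold region `{K_S⁶Z² < 64/27}` — the SAME number as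
the explicit all-time rung `θ(K)⁴ < 64/27` of `…SmallDissipationGapSharper` — is forward invariant,
and inside it `Z` decays exponentially in similarity time:

* `le_of_deriv_le_mul_add_Icc` — forward comparison for `f' ≤ af + b` on a window;
* `integral_sq_norm_lerayVorticity_le_of_forall_nat` — `R → ∞` in cutoff bounds;
* `deriv_sqCutoffEnstrophy_le_slice` — the SLICE-WISE damped budget: for a level `K_U ≥ 0` and
  weights `m, δ > 0` with `3θ(1+δ)/(2m⁴) ≤ 2` (`θ = √K_U(√K_S)³`) there is `L ≥ 0` such that at
  every instant `s` with `∫‖DU(s)‖² ≤ K_U`: `Z_R'(s) ≤ (θm¹²/2 − ½)Z_R(s) + (L/R)∫_{B̄_{2R}}‖Ω(s)‖²`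
  (`R ≥ 1`) — the hypothesis is used only at the instant `s` (the tree's
  `deriv_sqCutoffEnstrophy_le_sharper` needs it at all instants);
* `exists_damped_weights`, `exists_crude_weights` — the Young/product-rule weights below the
  threshold (damping `κ > 0`) and at an arbitrary level (growth rate `a`);
* (file 2/2 `…Trapping`: **`trapping`** — if `V ∈ 𝒟_{C,K}` has `K_S⁶ Z(s₀)² < 64/27` at ONE instant
  `s₀`, then `Z(s) ≤ Z(s₀)` for all `s ≥ s₀`, indeed `Z(s) ≤ e^{−κ(s−s₀)}Z(s₀)`; and the physical
  reading.)

The companion file `…EveryInstant` combines this with the orbit-limit / persistence machinery of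
`…Subthreshold` (ns-lqd-p1): a sub-threshold instant forces regularity at the apex, so the singular
profile has `K_S⁶ Z(s)² ≥ 64/27` at EVERY instant — no excursion below the explicit threshold, ever.

HONEST FRAMING. Statements about a HYPOTHETICAL object; the threshold is explicit in Mathlib's
(non-sharp) `K_S`; the decay rate `κ` is existential. Nothing is removed from the catalogued DSS
wall (`∀ c > 1, TypeIDSSLiouville c`, NECESSARY for the crux); verdict of the line unchanged
(FRONTIER). Nothing here bears on Navier–Stokes regularity or blow-up.

References: J. Leray, Acta Math. 63 (1934) §20; Koch–Nadirashvili–Seregin–Šverák, Acta Math. 203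
(2009) §4; Ladyzhenskaya's inequality; folklore energy method.
-/

noncomputable section

set_option linter.dupNamespace false

namespace Summit.NavierStokesRegularity.NavierStokesRegularity.Theorems.FiniteDissipationLiouville.Trapping

open MeasureTheory Set Filter Topology Metric InnerProductSpace Function Real
open scoped RealInnerProductSpace ContDiff ENNReal Laplacian
open Literature.Analysis Literature.Analysis.FluidPDE
open Summit.NavierStokesRegularity.NavierStokesRegularity.Theorems
open Summit.NavierStokesRegularity.NavierStokesRegularity.Theorems.GaussianGap
open Summit.NavierStokesRegularity.NavierStokesRegularity.Theorems.SimilarityEnstrophy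
open Summit.NavierStokesRegularity.NavierStokesRegularity.Theorems.SmallDissipationGap

variable {C : ℝ} {V : ℝ → (EuclideanSpace ℝ (Fin 3)) → (EuclideanSpace ℝ (Fin 3))}

/-! ### Two elementary tools -/

section Tools

/-- **Forward comparison on a window.** If `f` is differentiable and `f' ≤ a f + b` on `[s₀, s₁]`
(`a ≠ 0`), then `f(σ) ≤ e^{a(σ−s₀)}(f(s₀) + b/a) − b/a` for `σ ∈ [s₀, s₁]`:
`σ ↦ e^{−a(σ−s₀)}(f(σ) + b/a)` is non-increasing. [folklore] -/
theorem le_of_deriv_le_mul_add_Icc {f : ℝ → ℝ} (hd : Differentiable ℝ f) {a b s₀ s₁ : ℝ}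
    (ha : a ≠ 0) (hf' : ∀ σ ∈ Icc s₀ s₁, deriv f σ ≤ a * f σ + b) :
    ∀ σ ∈ Icc s₀ s₁, f σ ≤ Real.exp (a * (σ - s₀)) * (f s₀ + b / a) - b / a := by
  set h : ℝ → ℝ := fun σ => Real.exp (-(a * (σ - s₀))) * (f σ + b / a) with hh
  have hhd : ∀ σ, HasDerivAt h (Real.exp (-(a * (σ - s₀))) * (-a) * (f σ + b / a) +
      Real.exp (-(a * (σ - s₀))) * deriv f σ) σ := by
    intro σ
    have h1 : HasDerivAt (fun σ => Real.exp (-(a * (σ - s₀)))) (Real.exp (-(a * (σ - s₀))) * (-a)) σ := by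
      have := (((hasDerivAt_id σ).sub_const s₀).const_mul a).neg.exp
      simpa using this
    have h2 : HasDerivAt (fun σ => f σ + b / a) (deriv f σ) σ :=
      ((hd σ).hasDerivAt).add_const (b / a)
    have h3 : HasDerivAt (fun σ => Real.exp (-(a * (σ - s₀))) * (f σ + b / a))
        (Real.exp (-(a * (σ - s₀))) * (-a) * (f σ + b / a) +
          Real.exp (-(a * (σ - s₀))) * deriv f σ) σ := h1.mul h2
    exact h3
  have hanti : AntitoneOn h (Icc s₀ s₁) := by
    refine antitoneOn_of_deriv_nonpos (convex_Icc s₀ s₁)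
      (fun σ _ => (hhd σ).continuousAt.continuousWithinAt)
      (fun σ _ => (hhd σ).differentiableAt.differentiableWithinAt) fun σ hσ => ?_
    rw [interior_Icc] at hσ
    rw [(hhd σ).deriv]
    have hexp : 0 < Real.exp (-(a * (σ - s₀))) := Real.exp_pos _
    have hle := hf' σ (Ioo_subset_Icc_self hσ)
    have e : Real.exp (-(a * (σ - s₀))) * (-a) * (f σ + b / a) +
        Real.exp (-(a * (σ - s₀))) * deriv f σ =
        Real.exp (-(a * (σ - s₀))) * (deriv f σ - (a * f σ + b)) := by
      field_simp
      ring
    rw [e]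
    exact mul_nonpos_of_nonneg_of_nonpos hexp.le (by linarith)
  intro σ hσ
  have hs₀ : s₀ ∈ Icc s₀ s₁ := left_mem_Icc.2 (hσ.1.trans hσ.2)
  have hmono := hanti hs₀ hσ hσ.1
  have e0 : h s₀ = f s₀ + b / a := by simp [hh]
  rw [e0] at hmono
  have hexp : 0 < Real.exp (a * (σ - s₀)) := Real.exp_pos _
  have hprod : Real.exp (a * (σ - s₀)) * h σ = f σ + b / a := by
    simp only [hh]
    rw [← mul_assoc, ← Real.exp_add, add_neg_cancel, Real.exp_zero, one_mul]
  have := mul_le_mul_of_nonneg_left hmono hexp.le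
  rw [hprod] at this
  linarith

/-- **`R → ∞` in cutoff bounds.** If the squared-cutoff enstrophies of a slice of a member of
`𝒟_{C,K}` obey `Z_n(s) ≤ A + B/n` for all natural `n ≥ 1`, then `∫‖Ω(s)‖² ≤ A`
(`∫_{B̄_n}‖Ω‖² ≤ Z_n` and monotone convergence). [folklore] -/
theorem integral_sq_norm_lerayVorticity_le_of_forall_nat (hV : IsTypeIAncientMild C V) {K : ℝ}
    (hK : ∀ t : ℝ, t < 0 → ∫⁻ x, ‖fderiv ℝ (V t) x‖ₑ ^ 2 ≤ ENNReal.ofReal (K / Real.sqrt (-t)))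
    (s : ℝ) {A B : ℝ}
    (h : ∀ n : ℕ, 1 ≤ (n : ℝ) →
      (∫ y, smoothTransition (2 - ‖y‖ ^ 2 / (n : ℝ) ^ 2) ^ 2 * ‖lerayVorticity V s y‖ ^ 2) ≤ A + B / n) :
    ∫ y, ‖lerayVorticity V s y‖ ^ 2 ≤ A := by
  have hΩ := integrable_sq_norm_lerayVorticity hV hK s
  have hcΩ : Continuous (lerayVorticity V s) :=
    (signedBudget_contDiff_lerayVorticity_slice hV s (n := 1)).continuous
  have hball : ∀ n : ℕ, 1 ≤ (n : ℝ) →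
      (∫ y in closedBall (0 : EuclideanSpace ℝ (Fin 3)) n, ‖lerayVorticity V s y‖ ^ 2) ≤ A + B / n := by
    intro n hn
    have hR : 0 < (n : ℝ) := lt_of_lt_of_le one_pos hn
    refine le_trans ?_ (h n hn)
    have hint : Integrable fun y => smoothTransition (2 - ‖y‖ ^ 2 / (n : ℝ) ^ 2) ^ 2 *
        ‖lerayVorticity V s y‖ ^ 2 :=
      (((contDiff_sqCutoff (n := 1) (n : ℝ)).continuous).mul (hcΩ.norm.pow 2)).integrable_of_hasCompactSupport
        ((hasCompactSupport_sqCutoff hR).mul_right)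
    calc (∫ y in closedBall (0 : EuclideanSpace ℝ (Fin 3)) n, ‖lerayVorticity V s y‖ ^ 2)
        = ∫ y in closedBall (0 : EuclideanSpace ℝ (Fin 3)) n,
            smoothTransition (2 - ‖y‖ ^ 2 / (n : ℝ) ^ 2) ^ 2 * ‖lerayVorticity V s y‖ ^ 2 := by
          refine setIntegral_congr_fun measurableSet_closedBall fun y hy => ?_
          rw [mem_closedBall, dist_zero_right] at hy
          rw [sqCutoff_eq_one hR hy, one_mul]
      _ ≤ ∫ y, smoothTransition (2 - ‖y‖ ^ 2 / (n : ℝ) ^ 2) ^ 2 * ‖lerayVorticity V s y‖ ^ 2 :=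
          setIntegral_le_integral hint (Eventually.of_forall fun y =>
            mul_nonneg (sq_nonneg _) (sq_nonneg _))
  have hlim : Tendsto (fun n : ℕ =>
      ∫ y in closedBall (0 : EuclideanSpace ℝ (Fin 3)) n, ‖lerayVorticity V s y‖ ^ 2) atTop
      (𝓝 (∫ y, ‖lerayVorticity V s y‖ ^ 2)) := by
    have h := tendsto_setIntegral_of_monotone (μ := (volume : Measure (EuclideanSpace ℝ (Fin 3))))
      (s := fun n : ℕ => closedBall (0 : EuclideanSpace ℝ (Fin 3)) n)
      (f := fun y => ‖lerayVorticity V s y‖ ^ 2) (fun n => measurableSet_closedBall)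
      (fun m n hmn => closedBall_subset_closedBall (by exact_mod_cast hmn))
      (by rw [iUnion_closedBall_nat]; exact hΩ.1.integrableOn)
    rwa [iUnion_closedBall_nat, Measure.restrict_univ] at h
  have hlim0 : Tendsto (fun n : ℕ => A + B / n) atTop (𝓝 (A + 0)) :=
    (tendsto_const_div_atTop_nhds_zero_nat B).const_add A
  rw [add_zero] at hlim0
  exact le_of_tendsto_of_tendsto hlim hlim0 (Filter.eventually_atTop.2 ⟨1, fun n hn => hball n
    (by exact_mod_cast hn)⟩)

end Tools

/-! ### The slice-wise budget -/

section Slice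

/-- **The SLICE-WISE localised similarity-enstrophy budget with the Ladyzhenskaya pricing.** Let `V`
be a KNSS-gauge Type-I field with constant `C`. Fix a level `K_U ≥ 0`, `θ = √K_U·(√K_S)³`, and
weights `m, δ > 0` with `3θ(1+δ)/(2m⁴) ≤ 2` (the dissipation is not overspent). Then there is
`L ≥ 0` such that for every `R ≥ 1` and every instant `s` AT WHICH `∫‖DU(s)‖² ≤ K_U`:
`Z_R'(s) ≤ (θm¹²/2 − ½)·Z_R(s) + (L/R)·∫_{B̄_{2R}}‖Ω(s)‖²` (`Z_R = ∫φ_R²‖Ω‖²`). Same chain as the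
tree's `deriv_sqCutoffEnstrophy_le_sharper` (drift flux `≤ 0`, transport and viscous collar fluxes,
`two_mul_integral_sqCutoff_stretching_le_weighted`), but the dissipation hypothesis is used only at
the instant `s`. [folklore energy method; Ladyzhenskaya's inequality] -/
theorem deriv_sqCutoffEnstrophy_le_slice (hV : IsTypeIAncientMild C V) {KU m δ : ℝ}
    (hm : 0 < m) (hδ : 0 < δ)
    (hspend : 3 * (Real.sqrt KU * Real.sqrt (SNormLESNormFDerivOfEqConst (EuclideanSpace ℝ (Fin 3))
        (volume : Measure (EuclideanSpace ℝ (Fin 3))) 2 : ℝ) ^ 3) * (1 + δ) / (2 * m ^ 4) ≤ 2) :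
    ∃ L : ℝ, 0 ≤ L ∧ ∀ R : ℝ, 1 ≤ R → ∀ s : ℝ,
      Integrable (fun y => ‖fderiv ℝ (lerayOrbit V s) y‖ ^ 2) →
      (∫ y, ‖fderiv ℝ (lerayOrbit V s) y‖ ^ 2 ≤ KU) →
      deriv (fun σ => ∫ y, smoothTransition (2 - ‖y‖ ^ 2 / R ^ 2) ^ 2 * ‖lerayVorticity V σ y‖ ^ 2) s ≤
        ((Real.sqrt KU * Real.sqrt (SNormLESNormFDerivOfEqConst (EuclideanSpace ℝ (Fin 3))
            (volume : Measure (EuclideanSpace ℝ (Fin 3))) 2 : ℝ) ^ 3) * m ^ 12 / 2 - 1 / 2) *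
          (∫ y, smoothTransition (2 - ‖y‖ ^ 2 / R ^ 2) ^ 2 * ‖lerayVorticity V s y‖ ^ 2) +
          L / R * ∫ y in closedBall (0 : (EuclideanSpace ℝ (Fin 3))) (2 * R), ‖lerayVorticity V s y‖ ^ 2 := by
  obtain ⟨c₁, hc₁0, hc₁⟩ :=
    exists_norm_fderiv_smoothTransition_cutoff_le (E := (EuclideanSpace ℝ (Fin 3)))
  obtain ⟨c₂, hc₂0, hc₂⟩ :=
    exists_abs_laplacian_smoothTransition_cutoff_le (E := (EuclideanSpace ℝ (Fin 3)))
  have hC : 0 ≤ C := hV.nonneg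
  set θ : ℝ := Real.sqrt KU * Real.sqrt (SNormLESNormFDerivOfEqConst (EuclideanSpace ℝ (Fin 3))
    (volume : Measure (EuclideanSpace ℝ (Fin 3))) 2 : ℝ) ^ 3 with hθdef
  have hθ0 : 0 ≤ θ := by positivity
  refine ⟨2 * C * c₁ + 2 * c₂ + 6 * c₁ ^ 2 + 3 * θ / (2 * m ^ 4) * (1 + δ⁻¹) * c₁ ^ 2,
    by positivity, fun R hR1 s hint hKUs => ?_⟩
  have hR : 0 < R := lt_of_lt_of_le one_pos hR1
  rw [deriv_sqCutoffEnstrophy_eq hV hR s]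
  set φ : (EuclideanSpace ℝ (Fin 3)) → ℝ := fun z => smoothTransition (2 - ‖z‖ ^ 2 / R ^ 2) with hφdef
  set Ω := lerayVorticity V s with hΩdef
  set U := lerayOrbit V s with hUdef
  set I : ℝ := ∫ y in closedBall (0 : (EuclideanSpace ℝ (Fin 3))) (2 * R), ‖Ω y‖ ^ 2 with hIdef
  set Z : ℝ := ∫ y, φ y ^ 2 * ‖Ω y‖ ^ 2 with hZdef
  set D : ℝ := ∫ y, φ y ^ 2 * frobeniusNormSq (fderiv ℝ Ω y) with hDdef
  have hI0 : 0 ≤ I := integral_nonneg fun y => sq_nonneg _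
  have hZ0 : 0 ≤ Z := integral_nonneg fun y => mul_nonneg (sq_nonneg _) (sq_nonneg _)
  have hD0 : 0 ≤ D := integral_nonneg fun y => mul_nonneg (sq_nonneg _) (frobeniusNormSq_nonneg _)
  have hΩ1 : ContDiff ℝ 1 Ω := signedBudget_contDiff_lerayVorticity_slice hV s (n := 1)
  have hcΩ : Continuous Ω := hΩ1.continuous
  have hUC : ∀ y, ‖U y‖ ≤ C := fun y => norm_lerayOrbit_le_of_typeI hV s y
  have hw1 : ContDiff ℝ 1 fun z : (EuclideanSpace ℝ (Fin 3)) => φ z ^ 2 := contDiff_sqCutoff (n := 1) R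
  have hw2 : ContDiff ℝ 2 fun z : (EuclideanSpace ℝ (Fin 3)) => φ z ^ 2 := contDiff_sqCutoff (n := 2) R
  have hcDw : Continuous (fderiv ℝ fun z : (EuclideanSpace ℝ (Fin 3)) => φ z ^ 2) :=
    hw1.continuous_fderiv one_ne_zero
  -- (1) drift flux `≤ 0`
  have hDrift : (∫ y, fderiv ℝ (fun z : (EuclideanSpace ℝ (Fin 3)) => φ z ^ 2) y y * ‖Ω y‖ ^ 2) ≤ 0 :=
    integral_nonpos fun y => mul_nonpos_iff.2 (Or.inr ⟨fderiv_sqCutoff_self_nonpos R y, sq_nonneg _⟩)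
  -- (2) transport flux
  have hT : |∫ y, fderiv ℝ (fun z : (EuclideanSpace ℝ (Fin 3)) => φ z ^ 2) y (U y) * ‖Ω y‖ ^ 2| ≤
      C * (2 * (c₁ / R)) * I := by
    refine abs_integral_le_of_weight_sq hcΩ
      (w := fun y => C * ‖fderiv ℝ (fun z : (EuclideanSpace ℝ (Fin 3)) => φ z ^ 2) y‖)
      (continuous_const.mul hcDw.norm) (fun y hy => ?_) (fun y _ => ?_) (fun y => ?_)
    · show C * ‖fderiv ℝ (fun z : (EuclideanSpace ℝ (Fin 3)) => φ z ^ 2) y‖ = 0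
      rw [hφdef, fderiv_sqCutoff_eq_zero hR hy, norm_zero, mul_zero]
    · exact mul_le_mul_of_nonneg_left (norm_fderiv_sqCutoff_le hc₁ hR y) hC
    · rw [abs_mul, abs_of_nonneg (sq_nonneg ‖Ω y‖)]
      have e1 : |fderiv ℝ (fun z : (EuclideanSpace ℝ (Fin 3)) => φ z ^ 2) y (U y)| ≤
          ‖fderiv ℝ (fun z : (EuclideanSpace ℝ (Fin 3)) => φ z ^ 2) y‖ * C := by
        rw [← Real.norm_eq_abs]
        exact (ContinuousLinearMap.le_opNorm _ _).trans
          (mul_le_mul_of_nonneg_left (hUC y) (norm_nonneg _))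
      calc |fderiv ℝ (fun z : (EuclideanSpace ℝ (Fin 3)) => φ z ^ 2) y (U y)| * ‖Ω y‖ ^ 2
          ≤ (‖fderiv ℝ (fun z : (EuclideanSpace ℝ (Fin 3)) => φ z ^ 2) y‖ * C) * ‖Ω y‖ ^ 2 :=
            mul_le_mul_of_nonneg_right e1 (sq_nonneg _)
        _ = C * ‖fderiv ℝ (fun z : (EuclideanSpace ℝ (Fin 3)) => φ z ^ 2) y‖ * ‖Ω y‖ ^ 2 := by ring
  -- (3) viscous flux
  have hVisc : |∫ y, ‖Ω y‖ ^ 2 * (Δ (fun z : (EuclideanSpace ℝ (Fin 3)) => φ z ^ 2)) y| ≤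
      (2 * (c₂ / R ^ 2) + 6 * (c₁ / R) ^ 2) * I := by
    refine abs_integral_le_of_weight_sq hcΩ
      (w := fun y => |(Δ (fun z : (EuclideanSpace ℝ (Fin 3)) => φ z ^ 2)) y|)
      (continuous_laplacian hw2).abs (fun y hy => ?_) (fun y _ => ?_) (fun y => ?_)
    · show |(Δ (fun z : (EuclideanSpace ℝ (Fin 3)) => φ z ^ 2)) y| = 0
      rw [hφdef, laplacian_sqCutoff_eq_zero hR hy, abs_zero]
    · exact abs_laplacian_sqCutoff_le hc₁ hc₂ hR y
    · rw [abs_mul, abs_of_nonneg (sq_nonneg ‖Ω y‖), mul_comm]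
  -- (4) stretching, Ladyzhenskaya pricing at THIS slice
  have hS := two_mul_integral_sqCutoff_stretching_le_weighted hV hc₁ hR s hint hKUs hδ hm
  rw [← hθdef] at hS
  -- the dissipation is not overspent
  have hDsp : (3 * θ / (2 * m ^ 4)) * (1 + δ) * D ≤ 2 * D := by
    have e : (3 * θ / (2 * m ^ 4)) * (1 + δ) = 3 * θ * (1 + δ) / (2 * m ^ 4) := by ring
    rw [e]
    exact mul_le_mul_of_nonneg_right hspend hD0
  -- absorption of the collar terms
  have hT' := (le_abs_self _).trans hT
  have hVisc' := (le_abs_self _).trans hVisc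
  have hR2 : 1 / R ^ 2 ≤ 1 / R := by
    apply one_div_le_one_div_of_le hR
    nlinarith
  have hc₂R : c₂ / R ^ 2 ≤ c₂ / R := by
    have := mul_le_mul_of_nonneg_left hR2 hc₂0
    simpa only [mul_one_div] using this
  have hc₁R : (c₁ / R) ^ 2 ≤ c₁ ^ 2 / R := by
    rw [div_pow]
    have := mul_le_mul_of_nonneg_left hR2 (sq_nonneg c₁)
    simpa only [mul_one_div] using this
  have hθm : 0 ≤ 3 * θ / (2 * m ^ 4) * (1 + δ⁻¹) := by positivity
  have a3 : 3 * θ / (2 * m ^ 4) * (1 + δ⁻¹) * (c₁ / R) ^ 2 * I ≤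
      (3 * θ / (2 * m ^ 4) * (1 + δ⁻¹) * c₁ ^ 2) / R * I := by
    have h1 : 3 * θ / (2 * m ^ 4) * (1 + δ⁻¹) * (c₁ / R) ^ 2 ≤
        3 * θ / (2 * m ^ 4) * (1 + δ⁻¹) * (c₁ ^ 2 / R) := mul_le_mul_of_nonneg_left hc₁R hθm
    have e : 3 * θ / (2 * m ^ 4) * (1 + δ⁻¹) * (c₁ ^ 2 / R) =
        (3 * θ / (2 * m ^ 4) * (1 + δ⁻¹) * c₁ ^ 2) / R := by ring
    exact mul_le_mul_of_nonneg_right (h1.trans_eq e) hI0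
  have a4 : (2 * (c₂ / R ^ 2) + 6 * (c₁ / R) ^ 2) * I ≤ (2 * (c₂ / R) + 6 * (c₁ ^ 2 / R)) * I :=
    mul_le_mul_of_nonneg_right (by linarith [hc₂R, hc₁R]) hI0
  have e : (2 * C * c₁ + 2 * c₂ + 6 * c₁ ^ 2 + 3 * θ / (2 * m ^ 4) * (1 + δ⁻¹) * c₁ ^ 2) / R * I =
      C * (2 * (c₁ / R)) * I + (2 * (c₂ / R) + 6 * (c₁ ^ 2 / R)) * I +
        (3 * θ / (2 * m ^ 4) * (1 + δ⁻¹) * c₁ ^ 2) / R * I := by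
    field_simp
    ring
  rw [e]
  have eZ : (θ * m ^ 12 / 2 - 1 / 2) * Z = -(1 / 2) * Z + (θ * m ^ 12 / 2) * Z := by ring
  linarith [hDrift, hT', hVisc', hS, hDsp, a3, a4, eZ]

end Slice


/-! ### Weights -/

section Weights

/-- Damped weights below the threshold: for a level `k ≥ 0` with `θ⁴ < 64/27`, `θ = √k(√K_S)³`,
there are `m, δ, κ > 0` with `3θ(1+δ)/(2m⁴) ≤ 2` and `θm¹²/2 − ½ ≤ −κ` (`θ₁ = max θ 1`,
`(1+δ)³ < (64/27)/θ₁⁴`, `m⁴ = 3θ₁(1+δ)/4`, `κ = ½ − 27θ₁⁴(1+δ)³/128`). [folklore] -/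
theorem exists_damped_weights {k : ℝ} (hk : 0 ≤ k)
    (hθ : (Real.sqrt k * Real.sqrt (SNormLESNormFDerivOfEqConst (EuclideanSpace ℝ (Fin 3))
        (volume : Measure (EuclideanSpace ℝ (Fin 3))) 2 : ℝ) ^ 3) ^ 4 < 64 / 27) :
    ∃ m δ κ : ℝ, 0 < m ∧ 0 < δ ∧ 0 < κ ∧
      3 * (Real.sqrt k * Real.sqrt (SNormLESNormFDerivOfEqConst (EuclideanSpace ℝ (Fin 3))
        (volume : Measure (EuclideanSpace ℝ (Fin 3))) 2 : ℝ) ^ 3) * (1 + δ) / (2 * m ^ 4) ≤ 2 ∧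
      (Real.sqrt k * Real.sqrt (SNormLESNormFDerivOfEqConst (EuclideanSpace ℝ (Fin 3))
        (volume : Measure (EuclideanSpace ℝ (Fin 3))) 2 : ℝ) ^ 3) * m ^ 12 / 2 - 1 / 2 ≤ -κ := by
  set θ : ℝ := Real.sqrt k * Real.sqrt (SNormLESNormFDerivOfEqConst (EuclideanSpace ℝ (Fin 3))
        (volume : Measure (EuclideanSpace ℝ (Fin 3))) 2 : ℝ) ^ 3 with hθdef
  have _hk := hk
  have hθ0 : 0 ≤ θ := by positivity
  set θ₁ : ℝ := max θ 1 with hθ₁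
  have hθ₁1 : 1 ≤ θ₁ := le_max_right _ _
  have hθ₁pos : 0 < θ₁ := lt_of_lt_of_le one_pos hθ₁1
  have hθθ₁ : θ ≤ θ₁ := le_max_left _ _
  have hθ₁4 : θ₁ ^ 4 < 64 / 27 := by
    rcases le_total θ 1 with h | h
    · rw [hθ₁, max_eq_right h]; norm_num
    · rw [hθ₁, max_eq_left h]; exact hθ
  set ρ : ℝ := 64 / 27 / θ₁ ^ 4 with hρ
  have hθ₁4pos : 0 < θ₁ ^ 4 := by positivity
  have hρ1 : 1 < ρ := by rw [hρ, lt_div_iff₀ hθ₁4pos]; linarith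
  set δ : ℝ := min 1 ((ρ - 1) / 14) with hδdef
  have hδpos : 0 < δ := lt_min one_pos (by linarith)
  have hδ1 : δ ≤ 1 := min_le_left _ _
  have hδρ : (1 + δ) ^ 3 < ρ := by
    have h1 : δ ≤ (ρ - 1) / 14 := min_le_right _ _
    have hδ2 : δ ^ 2 ≤ δ := by nlinarith only [hδpos, hδ1]
    have hδ3 : δ ^ 3 ≤ δ := by nlinarith only [hδpos, hδ1, hδ2]
    have h2 : (1 + δ) ^ 3 ≤ 1 + 7 * δ := by nlinarith only [hδ2, hδ3]
    linarith
  set ν : ℝ := 27 * θ₁ ^ 4 * (1 + δ) ^ 3 / 128 with hνdef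
  have hνlt : ν < 1 / 2 := by
    have h1 : θ₁ ^ 4 * (1 + δ) ^ 3 < θ₁ ^ 4 * ρ := mul_lt_mul_of_pos_left hδρ hθ₁4pos
    have e : θ₁ ^ 4 * ρ = 64 / 27 := by rw [hρ]; field_simp
    rw [hνdef]
    rw [e] at h1
    linarith
  set q : ℝ := 3 * θ₁ * (1 + δ) / 4 with hq
  have hqpos : 0 < q := by positivity
  set m : ℝ := Real.sqrt (Real.sqrt q) with hm
  have hmpos : 0 < m := Real.sqrt_pos.2 (Real.sqrt_pos.2 hqpos)
  have hm4 : m ^ 4 = q := by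
    rw [show m ^ 4 = (m ^ 2) ^ 2 by ring, hm, Real.sq_sqrt (Real.sqrt_nonneg _), Real.sq_sqrt hqpos.le]
  have hm12 : m ^ 12 = q ^ 3 := by rw [show m ^ 12 = (m ^ 4) ^ 3 by ring, hm4]
  refine ⟨m, δ, 1 / 2 - ν, hmpos, hδpos, by linarith, ?_, ?_⟩
  · rw [hm4, hq, div_le_iff₀ (by positivity)]
    have := mul_le_mul_of_nonneg_right hθθ₁ (by positivity : (0:ℝ) ≤ 1 + δ)
    linarith
  · have h1 : θ * m ^ 12 / 2 ≤ θ₁ * m ^ 12 / 2 := by gcongr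
    have e : θ₁ * m ^ 12 / 2 = ν := by rw [hm12, hq, hνdef]; ring
    linarith

/-- Crude weights at any level: for `K_U` and `θ = √K_U(√K_S)³` there are `m, a > 0` with
`3θ(1+1)/(2m⁴) ≤ 2` and `θm¹²/2 − ½ ≤ a` (`m⁴ = 3·max θ 1/2`). [folklore] -/
theorem exists_crude_weights (KU : ℝ) :
    ∃ m a : ℝ, 0 < m ∧ 0 < a ∧
      3 * (Real.sqrt KU * Real.sqrt (SNormLESNormFDerivOfEqConst (EuclideanSpace ℝ (Fin 3))
        (volume : Measure (EuclideanSpace ℝ (Fin 3))) 2 : ℝ) ^ 3) * (1 + 1) / (2 * m ^ 4) ≤ 2 ∧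
      (Real.sqrt KU * Real.sqrt (SNormLESNormFDerivOfEqConst (EuclideanSpace ℝ (Fin 3))
        (volume : Measure (EuclideanSpace ℝ (Fin 3))) 2 : ℝ) ^ 3) * m ^ 12 / 2 - 1 / 2 ≤ a := by
  set θ : ℝ := Real.sqrt KU * Real.sqrt (SNormLESNormFDerivOfEqConst (EuclideanSpace ℝ (Fin 3))
        (volume : Measure (EuclideanSpace ℝ (Fin 3))) 2 : ℝ) ^ 3 with hθdef
  have hθ0 : 0 ≤ θ := by positivity
  set θ₂ : ℝ := max θ 1 with hθ₂
  have hθ₂pos : 0 < θ₂ := lt_of_lt_of_le one_pos (le_max_right _ _)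
  have hθθ₂ : θ ≤ θ₂ := le_max_left _ _
  set q : ℝ := 3 * θ₂ / 2 with hq
  have hqpos : 0 < q := by positivity
  set m : ℝ := Real.sqrt (Real.sqrt q) with hm
  have hmpos : 0 < m := Real.sqrt_pos.2 (Real.sqrt_pos.2 hqpos)
  have hm4 : m ^ 4 = q := by
    rw [show m ^ 4 = (m ^ 2) ^ 2 by ring, hm, Real.sq_sqrt (Real.sqrt_nonneg _), Real.sq_sqrt hqpos.le]
  refine ⟨m, θ₂ * m ^ 12 / 2 + 1, hmpos, by positivity, ?_, ?_⟩
  · rw [hm4, hq, div_le_iff₀ (by positivity)]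
    linarith
  · have h1 : θ * m ^ 12 / 2 ≤ θ₂ * m ^ 12 / 2 := by gcongr
    linarith

end Weights

end Summit.NavierStokesRegularity.NavierStokesRegularity.Theorems.FiniteDissipationLiouville.Trapping

end
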